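import Summits.Ventures.CertifiedManyBodySolver.Downfold.EmeryBoxesNCCOJetWindowP1
import Summits.Ventures.CertifiedManyBodySolver.Downfold.EmeryBoxesNCCOJetWindowP2
import Summits.Ventures.CertifiedManyBodySolver.Downfold.EmeryBoxesNCCOJetWindowP6
import Summits.Ventures.CertifiedManyBodySolver.Downfold.EmeryBoxesNCCOJetWindowP4
import Summits.Ventures.CertifiedManyBodySolver.Downfold.EmeryBoxesNCCOJetWindowS00c
import Summits.Ventures.CertifiedManyBodySolver.Downfold.EmeryBoxesNCCOJetWindowS10b
import Summits.Ventures.CertifiedManyBodySolver.Downfold.EmeryBoxesNCCOJetWindowS20b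
import Summits.Ventures.CertifiedManyBodySolver.Downfold.EmeryBoxesNCCOJetWindowS30b
import Summits.Ventures.CertifiedManyBodySolver.Downfold.EmeryFermiFillingLa214
import HarnessLib

/-!
# THE WHOLE-BAND (OBJECT-M) ONE-BAND SET AS CERTIFIED WINDOWS — Nd₂₋ₓCeₓCuO₄ x = 0.15 (NCCO, electron-doped), ν = 23/40 (n_H = 0.85, electron-doped) — ASSEMBLED: `(t_J, t′_J/t_J, t″_J/t_J)` of the nodal 2-jet at ε_F
# for EVERY member of the Nd₂₋ₓCeₓCuO₄ x = 0.15 σ companion `emeryBoxNCCOK26Src` (INFL-3to1-B §B.101)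

Venture CertifiedManyBodySolver, cell `pub/hubbard-downfold` (stage S1; INFLATION-RULES-3to1-B §B.101), seat hubbard-downfold-mod-4 (technique B = band
level, g45); namespace `Summit.Ventures.CertifiedManyBodySolver.Downfold.Emery`. Everything PROVED (`decide +kernel` on the bisection certificates of
`EmeryBandJetWindow.jetLeaf` — slope arithmetic `EmerySlopeArith(Sound)` — composed with the sub-box ε_F brackets of `EmeryFermiFillingNCCOSubs` and
`abFilling_fermiEnergyOf'`; generator HOME/hubbard-downfold-mod-4/jet-g45/gen/emit_boxes2.py, bit-exact python mirror of the kernel checker).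
WHAT THIS IS NOT: a statement about Nd₂₋ₓCeₓCuO₄ x = 0.15 (NCCO, electron-doped) — the typed box (the Nd₂₋ₓCeₓCuO₄ x = 0.15 σ companion `emeryBoxNCCOK26Src` ((K) source rows; t_pp [0.52, 0.72] eV, t_pp′ = 0.02)) is SCREENING-GRADE; `U = 0` one-body kinematics of the σ model; the ε_F coupling is per
SUB-BOX (each member's jet is bounded over its sub-box's certified ε_F bracket, not at its own ε_F), so the windows are OUTER bounds of the true ranges.

| Δ_pd range | window |
|---|---|
| whole Δ_pd hull [1.0, 2.05] | t_J [0.2711, 0.5402] eV, t′_J/t_J [-0.1838, -0.0049], t″_J/t_J [0.0313, 0.2428] |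

Sources: [HybertsenSchluterChristensen1989, Eq. (1)]; [AndersenEtAl1995, §6]; [PavariniEtAl2001, Eq. (1)]; interval/slope arithmetic [folklore].
-/

noncomputable section

namespace Summit.Ventures.CertifiedManyBodySolver.Downfold.Emery

open Real Set Literature.Analysis.ValidatedNumerics.Numerics

/-- **Nd₂₋ₓCeₓCuO₄ x = 0.15 (NCCO, electron-doped), whole Δ_pd hull [1.0, 2.05], ν = 23/40 (n_H = 0.85, electron-doped)** — for EVERY member θ = (Δ, t_pd, t_pp, t_pp′), with ε = ε_F(θ) and x₀ = xNode(ε_F): nodal-jet hopping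
`t_J ∈ [0.2711, 0.5402]` eV, `t′_J/t_J ∈ [-0.1838, -0.0049]`, `t″_J/t_J ∈ [0.0313, 0.2428]` (union of the sub-box windows 0_0, 0_1, 1_0, 1_1, 2_0, 2_1, 3_0, 3_1). [folklore] -/
theorem nccoBox_jetWindow_nu0575 {Δ a b c : ℝ} (hΔ : Δ ∈ Icc (1 : ℝ) (41 / 20 : ℝ)) (ha : a ∈ Icc (9 / 10 : ℝ) (129 / 100 : ℝ))
    (hb : b ∈ Icc (13 / 25 : ℝ) (18 / 25 : ℝ)) (hc : c ∈ Icc (1 / 50 : ℝ) (1 / 50 : ℝ)) :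
    jetT Δ a b c (xNode Δ a b c (fermiEnergyOf Δ a b c (23 / 40 : ℝ))) (fermiEnergyOf Δ a b c (23 / 40 : ℝ)) ∈ Icc (2711 / 10000 : ℝ) (2701 / 5000 : ℝ) ∧
      jetTp Δ a b c (xNode Δ a b c (fermiEnergyOf Δ a b c (23 / 40 : ℝ))) (fermiEnergyOf Δ a b c (23 / 40 : ℝ)) / jetT Δ a b c (xNode Δ a b c (fermiEnergyOf Δ a b c (23 / 40 : ℝ))) (fermiEnergyOf Δ a b c (23 / 40 : ℝ)) ∈ Icc (-919 / 5000 : ℝ) (-49 / 10000 : ℝ) ∧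
      jetTpp Δ a b c (xNode Δ a b c (fermiEnergyOf Δ a b c (23 / 40 : ℝ))) (fermiEnergyOf Δ a b c (23 / 40 : ℝ)) / jetT Δ a b c (xNode Δ a b c (fermiEnergyOf Δ a b c (23 / 40 : ℝ))) (fermiEnergyOf Δ a b c (23 / 40 : ℝ)) ∈ Icc (313 / 10000 : ℝ) (607 / 2500 : ℝ) := by
  rcases mem_Icc_split hΔ (61 / 40 : ℝ) with hΔ | hΔ
  · rcases mem_Icc_split hΔ (101 / 80 : ℝ) with hΔ | hΔ
    · rcases mem_Icc_split ha (219 / 200 : ℝ) with ha' | ha'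
      · exact (nccoJet_0_0 hΔ ha' hb hc).widen (by norm_num [SC]) (by norm_num [SC]) (by norm_num [SC])
          (by norm_num [SC]) (by norm_num [SC]) (by norm_num [SC])
      · exact (nccoJet_0_1 hΔ ha' hb hc).widen (by norm_num [SC]) (by norm_num [SC]) (by norm_num [SC])
          (by norm_num [SC]) (by norm_num [SC]) (by norm_num [SC])
    · rcases mem_Icc_split ha (219 / 200 : ℝ) with ha' | ha'
      · exact (nccoJet_1_0 hΔ ha' hb hc).widen (by norm_num [SC]) (by norm_num [SC]) (by norm_num [SC])
          (by norm_num [SC]) (by norm_num [SC]) (by norm_num [SC])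
      · exact (nccoJet_1_1 hΔ ha' hb hc).widen (by norm_num [SC]) (by norm_num [SC]) (by norm_num [SC])
          (by norm_num [SC]) (by norm_num [SC]) (by norm_num [SC])
  · rcases mem_Icc_split hΔ (143 / 80 : ℝ) with hΔ | hΔ
    · rcases mem_Icc_split ha (219 / 200 : ℝ) with ha' | ha'
      · exact (nccoJet_2_0 hΔ ha' hb hc).widen (by norm_num [SC]) (by norm_num [SC]) (by norm_num [SC])
          (by norm_num [SC]) (by norm_num [SC]) (by norm_num [SC])
      · exact (nccoJet_2_1 hΔ ha' hb hc).widen (by norm_num [SC]) (by norm_num [SC]) (by norm_num [SC])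
          (by norm_num [SC]) (by norm_num [SC]) (by norm_num [SC])
    · rcases mem_Icc_split ha (219 / 200 : ℝ) with ha' | ha'
      · exact (nccoJet_3_0 hΔ ha' hb hc).widen (by norm_num [SC]) (by norm_num [SC]) (by norm_num [SC])
          (by norm_num [SC]) (by norm_num [SC]) (by norm_num [SC])
      · exact (nccoJet_3_1 hΔ ha' hb hc).widen (by norm_num [SC]) (by norm_num [SC]) (by norm_num [SC])
          (by norm_num [SC]) (by norm_num [SC]) (by norm_num [SC])

end Summit.Ventures.CertifiedManyBodySolver.Downfold.Emery
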